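import Literature.MathematicalPhysics.QuantumFieldTheory.Federbush1986.AbelianModeEstimates

/-!
# Federbush I (CMP 107 (1986)) §2, inequality (2.5): `|A(e, r₀)| ≤ B₁ ℓ_{r₀}` for an edge `e` at the top level `r₀` — PROVED
# for the concrete r-approximate (2.1)–(2.2) (`approxTop`) of `Federbush1986/AbelianModeEstimates`

statement-level skeleton of published theorems with citation tags; proofs where landed; nothing here is a claim about the Yang–Mills mass gap

Cell `lit-balaban`, reader/typer block **r17 = Federbush**; row F1.Eq2.5-2.6 of `run/shared/lean/pub/lit-balaban/lit-balaban-r17/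
SKELETON-r17.md` (first half, (2.5)).  Print, p. 325 (render `renders/fedI/fed1986-cmp107-p007-x2.png` read as image): «We assume the
following bounds on the A_μ(x): |A_μ(x)| ≤ B₁, (2.3) |DA_μ(x)| ≤ B₂. (2.4) We denote by A(e, r₀) the assignment to edge e by the
r₀-approximate assignments due to A_μ(x). If e is at level r₀, we easily see from (2.1), (2.2), and (2.3) that |A(e, r₀)| ≤ B₁ℓ_{r₀}.
(2.5)».  Here: `|approxTop r A e| ≤ B₁ ℓ_r` for continuous `A` with `|A_μ(x)| ≤ B₁` (`abs_approxTop_le`), and hence for the carrier's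
`bondApprox r r` (`AbelianAveraging.abs_bondApprox_top_le`, via `av_self`).  The proof is the printed «easily see»: the tent weight
(2.2) is non-negative with `∫_{[0,1]³×[0,2]} tent(u_i) du = ∫_0^2 tent = 1` (Fubini), so `|ℓ_r ∫ tent·A_i| ≤ ℓ_r B₁`.  (2.6), the
bound at the lower levels through the averaged paths, is NOT proved here.
-/

namespace Literature.MathematicalPhysics.QuantumFieldTheory.Federbush1986

noncomputable section

open MeasureTheory Set intervalIntegral
open scoped BigOperators

/-- The tent (2.2) is `min(v, 2 − v)`. [cite: Federbush1986PhaseCellI, (2.2) p. 325] -/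
theorem tent_eq_min (v : ℝ) : tent v = min v (2 - v) := by
  unfold tent
  split_ifs with h
  · exact (min_eq_left (by linarith)).symm
  · exact (min_eq_right (by linarith)).symm

/-- The tent (2.2) is continuous. [cite: Federbush1986PhaseCellI, (2.2) p. 325] -/
theorem continuous_tent : Continuous tent := by
  have : tent = fun v => min v (2 - v) := funext tent_eq_min
  rw [this]
  exact continuous_id.min (continuous_const.sub continuous_id)

/-- The tent (2.2) is non-negative on `[0, 2]`. [cite: Federbush1986PhaseCellI, (2.2) p. 325] -/
theorem tent_nonneg {v : ℝ} (h0 : 0 ≤ v) (h2 : v ≤ 2) : 0 ≤ tent v := by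
  rw [tent_eq_min]; exact le_min h0 (by linarith)

/-- `∫_0^2 tent = 1` (the tent has unit mass, so (2.1) reproduces constants: `A(e, r) = ℓ_r A_i` for constant `A`).
[cite: Federbush1986PhaseCellI, (2.1)–(2.2) p. 325] -/
theorem integral_tent : ∫ v in (0 : ℝ)..2, tent v = 1 := by
  have h1 : ∫ v in (0 : ℝ)..1, tent v = 1 / 2 := by
    rw [integral_congr (g := fun v => v)]
    · rw [integral_id]; norm_num
    · intro v hv
      rw [uIcc_of_le zero_le_one] at hv
      show tent v = v
      unfold tent; rw [if_pos hv.2]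
  have h2 : ∫ v in (1 : ℝ)..2, tent v = 1 / 2 := by
    rw [integral_congr (g := fun v => 2 - v)]
    · rw [integral_sub intervalIntegrable_const intervalIntegrable_id, intervalIntegral.integral_const, integral_id]
      norm_num
    · intro v hv
      rw [uIcc_of_le one_le_two] at hv
      show tent v = 2 - v
      unfold tent
      split_ifs with h
      · have : v = 1 := le_antisymm h hv.1
        subst this; norm_num
      · rfl
  rw [← integral_add_adjacent_intervals (b := 1) (continuous_tent.intervalIntegrable _ _)
    (continuous_tent.intervalIntegrable _ _), h1, h2]
  norm_num

/-- The box of (2.1) in the `u`-coordinates: `[0,1]` in the three transverse coordinates, `[0,2]` in the direction `i`.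
[cite: Federbush1986PhaseCellI, (2.1) p. 325] -/
def boxUp (i : Fin 4) : Fin 4 → ℝ := fun k => if k = i then 2 else 1

/-- Fubini: `∫_{[0, boxUp i]} tent(u_i) du = ∫_0^2 tent · ∏_{k ≠ i} |[0,1]| = 1`. [cite: Federbush1986PhaseCellI, (2.1)–(2.2) p. 325] -/
theorem integral_box_tent (i : Fin 4) : ∫ u in Icc (0 : Fin 4 → ℝ) (boxUp i), tent (u i) = 1 := by
  -- the integrand as a product of one-variable functions
  let g : Fin 4 → ℝ → ℝ := fun k v => (Icc (0 : ℝ) (boxUp i k)).indicator (fun v => if k = i then tent v else 1) v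
  have key : ∀ u : Fin 4 → ℝ,
      (Icc (0 : Fin 4 → ℝ) (boxUp i)).indicator (fun u => tent (u i)) u = ∏ k, g k (u k) := by
    intro u
    by_cases hu : u ∈ Icc (0 : Fin 4 → ℝ) (boxUp i)
    · rw [indicator_of_mem hu]
      have hk : ∀ k, u k ∈ Icc (0 : ℝ) (boxUp i k) := fun k => ⟨hu.1 k, hu.2 k⟩
      have : ∀ k, g k (u k) = if k = i then tent (u k) else 1 := fun k => by
        simp only [g, indicator_of_mem (hk k)]
      simp_rw [this]
      rw [Finset.prod_ite_eq']
      simp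
    · rw [indicator_of_notMem hu]
      have : ∃ k, u k ∉ Icc (0 : ℝ) (boxUp i k) := by
        by_contra hc
        apply hu
        constructor
        · intro k; by_contra h'; exact hc ⟨k, fun hh => h' hh.1⟩
        · intro k; by_contra h'; exact hc ⟨k, fun hh => h' hh.2⟩
      obtain ⟨k, hk⟩ := this
      exact (Finset.prod_eq_zero (Finset.mem_univ k) (by simp only [g, indicator_of_notMem hk])).symm
  rw [← MeasureTheory.integral_indicator measurableSet_Icc]
  simp_rw [key]
  rw [integral_fintype_prod_volume_eq_prod]
  rw [Finset.prod_eq_single i]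
  · -- the `i`-th factor: ∫ over [0,2] of tent
    simp only [g, boxUp, if_true]
    rw [MeasureTheory.integral_indicator measurableSet_Icc, integral_Icc_eq_integral_Ioc,
      ← intervalIntegral.integral_of_le (by norm_num : (0 : ℝ) ≤ 2)]
    exact integral_tent
  · intro k _ hk
    simp only [g, boxUp, if_neg hk]
    rw [MeasureTheory.integral_indicator measurableSet_Icc]
    simp
  · simp

/-- **(2.5)**: «If e is at level r₀, we easily see from (2.1), (2.2), and (2.3) that |A(e, r₀)| ≤ B₁ℓ_{r₀}. (2.5)» — PROVED for
the concrete level-`r₀` term `approxTop` of the r-approximate, for every continuous `A` with (2.3) `|A_μ(x)| ≤ B₁`.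
[cite: Federbush1986PhaseCellI, (2.5) p. 325] -/
theorem abs_approxTop_le {r : ℕ} (A : E4 → Fin 4 → ℝ) (hA : Continuous A) {B₁ : ℝ} (hB : ∀ x μ, |A x μ| ≤ B₁)
    (e : Edge r) : |approxTop r A e| ≤ B₁ * latLen r := by
  have hB0 : 0 ≤ B₁ := le_trans (abs_nonneg _) (hB 0 0)
  have hℓ : 0 ≤ latLen r := by unfold latLen; positivity
  -- the integrand and its continuity
  set f : (Fin 4 → ℝ) → ℝ := fun u => tent (u e.dir) * A (e.src + latLen r • mkPt u) e.dir with hf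
  have hmk : Continuous (fun u : Fin 4 → ℝ => (mkPt u : E4)) := by
    unfold mkPt; exact PiLp.continuous_toLp 2 _
  have hfc : Continuous f := by
    refine (continuous_tent.comp (continuous_apply e.dir)).mul ?_
    have hAi : Continuous fun y : E4 => A y e.dir := (continuous_apply e.dir).comp hA
    exact hAi.comp (continuous_const.add (hmk.const_smul (latLen r)))
  have hS : MeasurableSet (Icc (0 : Fin 4 → ℝ) (boxUp e.dir)) := measurableSet_Icc
  have hK : IsCompact (Icc (0 : Fin 4 → ℝ) (boxUp e.dir)) := isCompact_Icc
  have hfi : IntegrableOn f (Icc (0 : Fin 4 → ℝ) (boxUp e.dir)) := hfc.continuousOn.integrableOn_compact hK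
  have hgi : IntegrableOn (fun u : Fin 4 → ℝ => B₁ * tent (u e.dir)) (Icc (0 : Fin 4 → ℝ) (boxUp e.dir)) :=
    ((continuous_const.mul (continuous_tent.comp (continuous_apply e.dir))).continuousOn).integrableOn_compact hK
  -- pointwise bound on the box
  have hpt : ∀ u ∈ Icc (0 : Fin 4 → ℝ) (boxUp e.dir), |f u| ≤ B₁ * tent (u e.dir) := by
    intro u hu
    have h0 : 0 ≤ u e.dir := hu.1 e.dir
    have h2 : u e.dir ≤ 2 := by have := hu.2 e.dir; simpa [boxUp] using this
    rw [hf, abs_mul, abs_of_nonneg (tent_nonneg h0 h2), mul_comm]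
    exact mul_le_mul_of_nonneg_right (hB _ _) (tent_nonneg h0 h2)
  have hint : |∫ u in Icc (0 : Fin 4 → ℝ) (boxUp e.dir), f u| ≤ B₁ := by
    calc |∫ u in Icc (0 : Fin 4 → ℝ) (boxUp e.dir), f u|
        ≤ ∫ u in Icc (0 : Fin 4 → ℝ) (boxUp e.dir), |f u| := by
          simpa only [Real.norm_eq_abs] using norm_integral_le_integral_norm f
      _ ≤ ∫ u in Icc (0 : Fin 4 → ℝ) (boxUp e.dir), B₁ * tent (u e.dir) :=
          setIntegral_mono_on hfi.abs hgi hS hpt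
      _ = B₁ * ∫ u in Icc (0 : Fin 4 → ℝ) (boxUp e.dir), tent (u e.dir) := integral_const_mul _ _
      _ = B₁ := by rw [integral_box_tent, mul_one]
  -- assemble
  have happrox : approxTop r A e = latLen r * ∫ u in Icc (0 : Fin 4 → ℝ) (boxUp e.dir), f u := rfl
  rw [happrox, abs_mul, abs_of_nonneg hℓ, mul_comm]
  exact mul_le_mul_of_nonneg_right hint hℓ

/-- (2.5) for the carrier: at the top level the r-approximate of any `AbelianAveraging` is `approxTop` (`av_self`), hence
`|A(e, r₀)| ≤ B₁ ℓ_{r₀}` for `C¹` (indeed continuous) `A` with (2.3). [cite: Federbush1986PhaseCellI, (2.5) p. 325] -/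
theorem AbelianAveraging.abs_bondApprox_top_le (D : AbelianAveraging) {r : ℕ} (A : E4 → Fin 4 → ℝ) (hA : ContDiff ℝ 1 A)
    {B₁ : ℝ} (hB : ∀ x μ, |A x μ| ≤ B₁) (e : Edge r) : |D.bondApprox r r A e| ≤ B₁ * latLen r := by
  unfold AbelianAveraging.bondApprox
  rw [D.av_self]
  exact abs_approxTop_le A hA.continuous hB e

end

end Literature.MathematicalPhysics.QuantumFieldTheory.Federbush1986
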